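import Summits.Ventures.PercRepro.ProfileFlatUpset

/-!
# PercRepro — THE GIRTH REGIME OF (H-gen): WHEN EVERY `(n − k + 1)`-SUBSET IS INDEPENDENT, THE MIRROR STATEMENT AT LEVEL
`k` IS THE NORMALISED MATCHING PROPERTY OF THE BOOLEAN LATTICE (p10, gen 26; unconditional)

For a finite matroid `M` on `n` elements, an up-set `U` of its flats and a level `2k < n`, the mirror statement (H-gen)
(ProfilePointedMirrorUpset, `SepMirror`) reads, in its closure form, `#{X ∈ BI_k : cl X ∈ U} ≤ #{X ∈ BI_{n−k} : cl X ∈ U}`.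
THIS FILE proves it at every level `k` at which EVERY `(n − k + 1)`-subset of `E` is independent (`girth(M) ≥ n − k + 2`):
there the bi-independent sets of the sizes `k … n − k` are ALL the subsets of those sizes and each is its own closure
(`clF_eq_self_of_indep_succ`), so the sets with closure in `U` form an interval `𝒰_k, …, 𝒰_{n−k}` of an up-set of the Boolean
lattice of `E`, and the local LYM double count `#𝒰_j·(n − j) ≤ #𝒰_{j+1}·(j + 1)` (`card_mul_le_card_mul_of_insert_mem`, every
`j`-set has `n − j` one-element supersets in `𝒰_{j+1}`, every `(j+1)`-set at most `j + 1` subsets) telescopes through the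
binomials to `#𝒰_k ≤ #𝒰_{n−k}` (`le_of_level_step`).  So the girth regime of (H-gen) is the normalised matching property
of the Boolean lattice — the analogue of gen 25's girth regimes of (Ĉ) and (D).  Nothing here asserts (H-gen) or (H).
-/

open scoped Matroid

namespace PercRepro.Cogirth

open Finset ThmH Skew

variable {α : Type} [DecidableEq α] {M : Matroid α} [M.Finite]

/-! ### The Boolean local LYM step, finset form -/

/-- **Local LYM, upward, for a finset ground set**: if every one-element extension inside `E` of a `j`-set of `𝒜` lies in
the family `ℬ` of `(j+1)`-sets, then `#𝒜·(#E − j) ≤ #ℬ·(j + 1)` (double count of the pairs `X ⊂ Y`). -/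
theorem card_mul_le_card_mul_of_insert_mem {E : Finset α} {𝒜 ℬ : Finset (Finset α)} {j : ℕ}
    (h𝒜 : ∀ X ∈ 𝒜, X ⊆ E ∧ X.card = j) (hℬ : ∀ Y ∈ ℬ, Y.card = j + 1)
    (hins : ∀ X ∈ 𝒜, ∀ a ∈ E, a ∉ X → insert a X ∈ ℬ) :
    𝒜.card * (E.card - j) ≤ ℬ.card * (j + 1) := by
  classical
  refine card_mul_le_card_mul (fun X Y => X ⊆ Y) ?_ ?_
  · intro X hX
    obtain ⟨hXE, hXj⟩ := h𝒜 X hX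
    have himg : (E \ X).image (fun a => insert a X) ⊆ ℬ.bipartiteAbove (fun X Y => X ⊆ Y) X := by
      intro Y hY
      rw [mem_image] at hY
      obtain ⟨a, ha, rfl⟩ := hY
      rw [mem_sdiff] at ha
      rw [mem_bipartiteAbove]
      exact ⟨hins X hX a ha.1 ha.2, subset_insert _ _⟩
    have hinj : Set.InjOn (fun a => insert a X) (E \ X : Finset α) := by
      intro a ha b hb hab
      simp only at hab
      rw [mem_coe, mem_sdiff] at ha hb
      have : a ∈ insert b X := hab ▸ mem_insert_self a X
      rw [mem_insert] at this
      rcases this with h | h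
      · exact h
      · exact absurd h ha.2
    calc E.card - j = (E \ X).card := by rw [card_sdiff_of_subset hXE, hXj]
      _ = ((E \ X).image (fun a => insert a X)).card := (card_image_of_injOn hinj).symm
      _ ≤ (ℬ.bipartiteAbove (fun X Y => X ⊆ Y) X).card := card_le_card himg
  · intro Y hY
    have hsub : 𝒜.bipartiteBelow (fun X Y => X ⊆ Y) Y ⊆ Y.image (fun a => Y.erase a) := by
      intro X hX
      rw [mem_bipartiteBelow] at hX
      obtain ⟨hX𝒜, hXY⟩ := hX
      obtain ⟨-, hXj⟩ := h𝒜 X hX𝒜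
      have hYc := hℬ Y hY
      obtain ⟨a, haY, haX⟩ : ∃ a ∈ Y, a ∉ X := by
        by_contra hcon
        have hYX : Y ⊆ X := fun y hy => by
          by_contra h
          exact hcon ⟨y, hy, h⟩
        have := card_le_card hYX
        omega
      rw [mem_image]
      refine ⟨a, haY, ?_⟩
      symm
      apply eq_of_subset_of_card_le
      · intro x hx
        rw [mem_erase]
        exact ⟨fun h => haX (h ▸ hx), hXY hx⟩
      · rw [card_erase_of_mem haY, hYc, hXj]
        omega
    calc (𝒜.bipartiteBelow (fun X Y => X ⊆ Y) Y).card ≤ (Y.image (fun a => Y.erase a)).card := card_le_card hsub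
      _ ≤ Y.card := card_image_le
      _ = j + 1 := hℬ Y hY

/-! ### Telescoping through the binomials -/

/-- A sequence with `f j·(n − j) ≤ f (j+1)·(j + 1)` on the levels `k ≤ j < n − k` satisfies `f k ≤ f (n − k)` for `2k ≤ n`:
`f j / C(n, j)` is non-decreasing on the interval and `C(n, k) = C(n, n − k)`. -/
theorem le_of_level_step {n k : ℕ} (f : ℕ → ℕ) (hk : 2 * k ≤ n)
    (hstep : ∀ j, k ≤ j → j < n - k → f j * (n - j) ≤ f (j + 1) * (j + 1)) : f k ≤ f (n - k) := by
  have key : ∀ d, k + d ≤ n - k → f k * n.choose (k + d) ≤ f (k + d) * n.choose k := by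
    intro d
    induction d with
    | zero => intro _; rw [add_zero]
    | succ d ih =>
      intro hd
      have ih' := ih (by omega)
      have hs := hstep (k + d) (by omega) (by omega)
      have hc := Nat.choose_succ_right_eq n (k + d)
      have hpos : 0 < k + d + 1 := by omega
      have h1 : f k * n.choose (k + d + 1) * (k + d + 1) ≤ f (k + d + 1) * n.choose k * (k + d + 1) := by
        calc f k * n.choose (k + d + 1) * (k + d + 1) = f k * (n.choose (k + d + 1) * (k + d + 1)) := by ring
          _ = f k * (n.choose (k + d) * (n - (k + d))) := by rw [hc]
          _ = (f k * n.choose (k + d)) * (n - (k + d)) := by ring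
          _ ≤ (f (k + d) * n.choose k) * (n - (k + d)) := Nat.mul_le_mul_right _ ih'
          _ = (f (k + d) * (n - (k + d))) * n.choose k := by ring
          _ ≤ (f (k + d + 1) * (k + d + 1)) * n.choose k := Nat.mul_le_mul_right _ hs
          _ = f (k + d + 1) * n.choose k * (k + d + 1) := by ring
      rw [show k + (d + 1) = k + d + 1 by omega]
      exact Nat.le_of_mul_le_mul_right h1 hpos
  have h := key (n - 2 * k) (by omega)
  rw [show k + (n - 2 * k) = n - k by omega, Nat.choose_symm (by omega : k ≤ n)] at h
  have hpos : 0 < n.choose k := Nat.choose_pos (by omega)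
  exact Nat.le_of_mul_le_mul_right h hpos

/-! ### The matroid translation in the girth regime -/

/-- In the regime «every subset with at most `m + 1` elements is independent», a subset with at most `m` elements is its own
closure. -/
theorem clF_eq_self_of_indep_succ {m : ℕ} (hg : ∀ S ⊆ gr M, S.card ≤ m + 1 → rk M S = S.card)
    {X : Finset α} (hX : X ⊆ gr M) (hXm : X.card ≤ m) : clF M X = X := by
  apply Subset.antisymm
  · intro e he
    by_contra heX
    have heg : e ∈ gr M := clF_subset_gr_fu X he
    have h1 := rk_insert_eq heg hX
    rw [if_pos he] at h1
    have h2 := hg (insert e X) (insert_subset heg hX) (by rw [card_insert_of_notMem heX]; omega)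
    have h3 := hg X hX (by omega)
    rw [card_insert_of_notMem heX] at h2
    omega
  · exact subset_clF_fu hX

/-- In the regime «every subset with at most `n − k + 1` elements is independent» every subset of `E` with `j` elements,
`k ≤ j ≤ n − k`, is bi-independent. -/
theorem mem_biIndepSets_of_indep_of_card {k j : ℕ} (hk : 2 * k ≤ (gr M).card)
    (hg : ∀ S ⊆ gr M, S.card ≤ (gr M).card - k + 1 → rk M S = S.card) {X : Finset α} (hX : X ⊆ gr M)
    (hXj : X.card = j) (hkj : k ≤ j) (hjk : j ≤ (gr M).card - k) : X ∈ biIndepSets M j := by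
  rw [mem_biIndepSets]
  refine ⟨hX, hXj, hg X hX (by omega), hg (gr M \ X) sdiff_subset ?_⟩
  rw [card_sdiff_of_subset hX, hXj]
  omega

/-- The members of `U` among the `j`-subsets of `E`. -/
noncomputable def upLevel (M : Matroid α) [M.Finite] (U : Finset (Finset α)) (j : ℕ) : Finset (Finset α) :=
  ((gr M).powersetCard j).filter (fun X => X ∈ U)

/-- In the girth regime, the bi-independent `j`-sets with closure in `U` (`k ≤ j ≤ n − k`) are the `j`-subsets of `E` in `U`. -/
theorem filter_clF_mem_eq_upLevel {k j : ℕ} (hk : 2 * k ≤ (gr M).card)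
    (hg : ∀ S ⊆ gr M, S.card ≤ (gr M).card - k + 1 → rk M S = S.card) (U : Finset (Finset α))
    (hkj : k ≤ j) (hjk : j ≤ (gr M).card - k) :
    (biIndepSets M j).filter (fun X => clF M X ∈ U) = upLevel M U j := by
  ext X
  unfold upLevel
  rw [mem_filter, mem_filter, mem_powersetCard]
  constructor
  · rintro ⟨hXb, hcl⟩
    have hXg : X ⊆ gr M := (mem_biIndepSets.1 hXb).1
    have hXj : X.card = j := (mem_biIndepSets.1 hXb).2.1
    rw [clF_eq_self_of_indep_succ hg hXg (by omega)] at hcl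
    exact ⟨⟨hXg, hXj⟩, hcl⟩
  · rintro ⟨⟨hXg, hXj⟩, hU⟩
    refine ⟨mem_biIndepSets_of_indep_of_card hk hg hXg hXj hkj hjk, ?_⟩
    rw [clF_eq_self_of_indep_succ hg hXg (by omega)]
    exact hU

/-- **THE GIRTH REGIME OF (H-gen)** (unconditional): if every `(n − k + 1)`-subset of `E` is independent and `2k < n`, then
`#{X ∈ BI_k : cl X ∈ U} ≤ #{X ∈ BI_{n−k} : cl X ∈ U}` for every up-set `U` of flats. -/
theorem card_filter_clF_mem_le_mirror_of_indep {k : ℕ} (hk : 2 * k < (gr M).card)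
    (hg : ∀ S ⊆ gr M, S.card ≤ (gr M).card - k + 1 → rk M S = S.card) {U : Finset (Finset α)}
    (hU : UpFlats M U) :
    ((biIndepSets M k).filter (fun X => clF M X ∈ U)).card ≤
      ((biIndepSets M ((gr M).card - k)).filter (fun X => clF M X ∈ U)).card := by
  rw [filter_clF_mem_eq_upLevel (by omega) hg U le_rfl (by omega),
    filter_clF_mem_eq_upLevel (by omega) hg U (by omega) le_rfl]
  apply le_of_level_step (n := (gr M).card) (k := k) (fun j => (upLevel M U j).card) (by omega)
  intro j hkj hjk
  apply card_mul_le_card_mul_of_insert_mem (E := gr M) (j := j)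
  · intro X hX
    unfold upLevel at hX
    rw [mem_filter, mem_powersetCard] at hX
    exact hX.1
  · intro Y hY
    unfold upLevel at hY
    rw [mem_filter, mem_powersetCard] at hY
    exact hY.1.2
  · intro X hX a ha haX
    unfold upLevel at hX ⊢
    rw [mem_filter, mem_powersetCard] at hX ⊢
    obtain ⟨⟨hXg, hXj⟩, hXU⟩ := hX
    have hins : insert a X ⊆ gr M := insert_subset ha hXg
    have hcard : (insert a X).card = j + 1 := by rw [card_insert_of_notMem haX, hXj]
    refine ⟨⟨hins, hcard⟩, ?_⟩
    refine hU.up X hXU (insert a X) ⟨hins, clF_eq_self_of_indep_succ hg hins (by omega)⟩ (subset_insert _ _)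

end PercRepro.Cogirth
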